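import Literature.AlgebraicGeometry.Motives.FanoUniversalLine
import Mathlib.RingTheory.LocalRing.ResidueField.Basic
import HarnessLib

/-!
# The linear forms of a line in a Plücker chart: independence of reductions and vanishing

Pure (linear-)algebra input for the product trick over a two-dimensional base (the integral
forms at a base point, read off a chart of the Grassmannian). For the Plücker coordinates
`p = u ∧ r` of the line `span(u, r)` and a chart index pair `(a₁, a₂)` with `p_{a₁a₂} ≠ 0`, the
`N - 1` point–line incidence forms (`FanoScheme.pointLineRel`, Eisenbud–Harris §3.2.3)

  `Λ_m = x_m - (p_{a₁m}/p_{a₁a₂}) x_{a₂} + (p_{a₂m}/p_{a₁a₂}) x_{a₁}`,   `m ∉ {a₁, a₂}`,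

vanish on `span(u, r)` (`eval_chartLineForm_eq_zero`, the `3 × 3` minors of `(u; r; x)`), and any
family of coefficient vectors of this unit-triangular shape — `e_m + α_m e_{a₂} + β_m e_{a₁}` with
arbitrary scalars — is linearly independent (`linearIndependent_chartVectors`); in particular their
reductions modulo the maximal ideal of a local ring of coefficients are
(`linearIndependent_residue_chartVectors`). The index set `{m : m ∉ {a₁, a₂}}` is enumerated by
`Fin (N - 1)` (`exists_embedding_compl_pair`). Everything is proved. [folklore]

## References

* [EisenbudHarris2016] D. Eisenbud, J. Harris, *3264 and All That*, §3.2.1–3.2.3.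
-/

noncomputable section

open MvPolynomial

universe u

namespace Literature.AlgebraicGeometry.Motives

namespace FanoScheme

/-! ### Enumerating the complement of two indices -/

/-- For `a₁ ≠ a₂` in `Fin (N + 1)`, `1 ≤ N`, an injection `Fin (N - 1) ↪ Fin (N + 1)` avoiding
`a₁` and `a₂`. [folklore] -/
theorem exists_embedding_compl_pair {N : ℕ} (hN : 1 ≤ N) {a₁ a₂ : Fin (N + 1)} (h : a₁ ≠ a₂) :
    ∃ ε : Fin (N - 1) → Fin (N + 1), Function.Injective ε ∧ ∀ l, ε l ≠ a₁ ∧ ε l ≠ a₂ := by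
  classical
  -- the complement has `N - 1` elements; enumerate it
  let s : Finset (Fin (N + 1)) := Finset.univ.erase a₁ |>.erase a₂
  have hcard : s.card = N - 1 := by
    have h2 : a₂ ∈ Finset.univ.erase a₁ := Finset.mem_erase.2 ⟨h.symm, Finset.mem_univ _⟩
    rw [Finset.card_erase_of_mem h2, Finset.card_erase_of_mem (Finset.mem_univ _),
      Finset.card_univ, Fintype.card_fin]
    omega
  let e : Fin (N - 1) ≃ s := (Finset.equivFinOfCardEq hcard).symm
  refine ⟨fun l => (e l : Fin (N + 1)), fun l l' hll' => e.injective (Subtype.ext hll'), fun l => ?_⟩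
  have hmem : ((e l : s) : Fin (N + 1)) ∈ s := (e l).2
  simp only [s, Finset.mem_erase] at hmem
  exact ⟨hmem.2.1, hmem.1⟩

/-! ### Unit-triangular families are independent -/

/-- A family of vectors `w_l` with `w_l (ε l') = δ_{l l'}` for an injection `ε` is linearly
independent (read off the `ε l'`-coordinates of a vanishing combination). [folklore] -/
theorem linearIndependent_of_apply_embedding {R : Type u} [CommRing R] [Nontrivial R] {ι σ : Type*}
    [Fintype ι] [DecidableEq ι] {ε : ι → σ} {w : ι → σ → R}
    (hw : ∀ l l', w l (ε l') = if l = l' then 1 else 0) : LinearIndependent R w := by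
  rw [Fintype.linearIndependent_iff]
  intro c hc l'
  have h := congr_fun hc (ε l')
  simp only [Finset.sum_apply, Pi.smul_apply, smul_eq_mul, Pi.zero_apply] at h
  rw [Finset.sum_eq_single l' (fun l _ hl => by rw [hw, if_neg hl, mul_zero])
    (fun hl => absurd (Finset.mem_univ l') hl), hw, if_pos rfl, mul_one] at h
  exact h

/-- **The chart vectors are independent**: for an injection `ε` avoiding `a₁, a₂` and arbitrary
scalars `α_l, β_l`, the vectors `e_{ε l} + α_l e_{a₂} + β_l e_{a₁}` are linearly independent.
[folklore] -/
theorem linearIndependent_chartVectors {R : Type u} [CommRing R] [Nontrivial R] {N r : ℕ}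
    {a₁ a₂ : Fin (N + 1)} {ε : Fin r → Fin (N + 1)} (hε : Function.Injective ε)
    (hε₁ : ∀ l, ε l ≠ a₁) (hε₂ : ∀ l, ε l ≠ a₂) (α β : Fin r → R) :
    LinearIndependent R fun l => (Pi.single (ε l) (1 : R) + α l • Pi.single a₂ (1 : R) +
      β l • Pi.single a₁ (1 : R) : Fin (N + 1) → R) := by
  classical
  refine linearIndependent_of_apply_embedding (ε := ε) fun l l' => ?_
  simp only [Pi.add_apply, Pi.smul_apply, smul_eq_mul, Pi.single_apply]
  rw [if_neg (hε₂ l'), if_neg (hε₁ l'), mul_zero, mul_zero, add_zero, add_zero]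
  by_cases h : l = l'
  · subst h; simp
  · rw [if_neg (fun h' => h (hε h').symm), if_neg h]

/-- **Independence of the reductions**: over a local ring `O`, the reductions modulo the maximal
ideal of the chart vectors `e_{ε l} + g_l e_{a₂} + g'_l e_{a₁}` (`g_l, g'_l ∈ O` arbitrary) are
linearly independent over the residue field. [folklore] -/
theorem linearIndependent_residue_chartVectors {O : Type u} [CommRing O] [IsLocalRing O] {N r : ℕ}
    {a₁ a₂ : Fin (N + 1)} {ε : Fin r → Fin (N + 1)} (hε : Function.Injective ε)
    (hε₁ : ∀ l, ε l ≠ a₁) (hε₂ : ∀ l, ε l ≠ a₂) (g g' : Fin r → O) :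
    LinearIndependent (IsLocalRing.ResidueField O) fun l j =>
      IsLocalRing.residue O ((Pi.single (ε l) (1 : O) + g l • Pi.single a₂ (1 : O) +
        g' l • Pi.single a₁ (1 : O) : Fin (N + 1) → O) j) := by
  classical
  have h := linearIndependent_chartVectors (R := IsLocalRing.ResidueField O) hε hε₁ hε₂
    (fun l => IsLocalRing.residue O (g l)) (fun l => IsLocalRing.residue O (g' l))
  have hfam : (fun l j => IsLocalRing.residue O ((Pi.single (ε l) (1 : O) + g l • Pi.single a₂ (1 : O) +
      g' l • Pi.single a₁ (1 : O) : Fin (N + 1) → O) j)) =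
      fun l => (Pi.single (ε l) (1 : IsLocalRing.ResidueField O) +
        IsLocalRing.residue O (g l) • Pi.single a₂ (1 : IsLocalRing.ResidueField O) +
        IsLocalRing.residue O (g' l) • Pi.single a₁ (1 : IsLocalRing.ResidueField O) :
          Fin (N + 1) → IsLocalRing.ResidueField O) := by
    funext l j
    simp only [Pi.add_apply, Pi.smul_apply, smul_eq_mul, map_add, map_mul, Pi.single_apply,
      apply_ite (IsLocalRing.residue O), map_one, map_zero]
  rw [hfam]
  exact h

/-! ### The chart forms vanish on the line -/

/-- **The chart form `Λ_m = x_m - (p_{a₁m}/p_{a₁a₂}) x_{a₂} + (p_{a₂m}/p_{a₁a₂}) x_{a₁}` vanishes on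
`span(u, r)`** (`p = u ∧ r`, `p_{a₁a₂} ≠ 0`): up to the unit `p_{a₁a₂}` it is the point–line
incidence minor. [cite: EisenbudHarris2016, §3.2.3] -/
theorem eval_chartLineForm_eq_zero {L : Type u} [Field L] {N : ℕ} (u r : Fin (N + 1) → L)
    {a₁ a₂ : Fin (N + 1)} (ha : wedge u r a₁ a₂ ≠ 0) (m : Fin (N + 1))
    {x : Fin (N + 1) → L} (hx : x ∈ Submodule.span L {u, r}) :
    eval x ((X m : MvPolynomial (Fin (N + 1)) L) - C (wedge u r a₁ m / wedge u r a₁ a₂) * X a₂ +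
      C (wedge u r a₂ m / wedge u r a₁ a₂) * X a₁) = 0 := by
  obtain ⟨α, β, rfl⟩ := Submodule.mem_span_pair.mp hx
  simp only [map_add, map_sub, map_mul, eval_C, eval_X, Pi.add_apply, Pi.smul_apply, smul_eq_mul]
  rw [div_mul_eq_mul_div, div_mul_eq_mul_div, sub_add, ← sub_div, sub_eq_zero, eq_div_iff ha]
  simp only [wedge]
  ring

/-- The coefficient vector of the chart form: `Λ_m = lin (e_m - (p_{a₁m}/p_{a₁a₂}) e_{a₂} + (p_{a₂m}/p_{a₁a₂}) e_{a₁})`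
evaluates as the form. [folklore] -/
theorem eval_sum_chartVector_mul (L : Type u) [Field L] {N : ℕ} (p : Fin (N + 1) → Fin (N + 1) → L)
    (a₁ a₂ m : Fin (N + 1)) (x : Fin (N + 1) → L) :
    ∑ j, (Pi.single m (1 : L) + (-(p a₁ m / p a₁ a₂)) • Pi.single a₂ (1 : L) +
        (p a₂ m / p a₁ a₂) • Pi.single a₁ (1 : L) : Fin (N + 1) → L) j * x j =
      eval x ((X m : MvPolynomial (Fin (N + 1)) L) - C (p a₁ m / p a₁ a₂) * X a₂ +
        C (p a₂ m / p a₁ a₂) * X a₁) := by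
  classical
  simp only [Pi.add_apply, Pi.smul_apply, smul_eq_mul, Pi.single_apply, add_mul, Finset.sum_add_distrib,
    ite_mul, one_mul, zero_mul, mul_ite, mul_one, mul_zero, Finset.sum_ite_eq',
    Finset.mem_univ, if_true, map_add, map_sub, map_mul, eval_C, eval_X]
  ring

end FanoScheme

end Literature.AlgebraicGeometry.Motives

end
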